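import Summits.NavierStokesRegularity.NavierStokesRegularity.Theorems.ScaledTopAlignmentBulkRung
import Summits.NavierStokesRegularity.NavierStokesRegularity.Theorems.ScaledTopAlignmentRegularCase
import HarnessLib

/-!
# Route `ScaledTopAlignment`: the REGULAR CASE of the window-bulk door W3ʷᵇ = `AprioriWindowBulkAlignment`
# (stmt-NavierStokesRegularity-19447, load-bearing since rev 9–10) — W3ʷᵇ is equivalent to W3ʷᵇ at first blow-up times

Planner p3 g3, for the tribunal / refuters (T1/T3 structure of the deciding crux): exactly as p5 showed for the pointwise door W3
(`aprioriScaledTopAlignment_iff_singular`), ALL content of W3ʷᵇ sits at solutions that do NOT extend classically past `T`: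
* `windowBulkAlignedAt_of_hasSmoothExtensionPast` — a solution extending past `T` satisfies W3ʷᵇ's conclusion (λ₀ = ½, R₀ = 1; the misaligned
  window set is empty above the regular-case threshold of W3);
* `windowBulkAlignedAt_of_lt` — on every `[0, T'')`, `T'' < T`, W3ʷᵇ's conclusion holds UNCONDITIONALLY (so a refutation of W3ʷᵇ must exhibit a
  solution with no classical extension past some `T`, i.e. a blow-up: refuting the door is as hard as refuting NS regularity in this class);
* `aprioriWindowBulkAlignment_iff_singular` — W3ʷᵇ ↔ W3ʷᵇ restricted to non-extendable solutions (with the route's residual NoTypeII these are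
  Type-I blow-up times — the regime of GAP‴ and of the window-Fatou kit).
Equivalences/implications about an OPEN statement; nothing is proved about W3ʷᵇ itself. WHAT THIS IS NOT: not NS regularity. [folklore]
-/

noncomputable section
set_option linter.dupNamespace false
open MeasureTheory Set Filter Topology Literature.Analysis.FluidPDE

namespace Summit.NavierStokesRegularity.NavierStokesRegularity.Theorems

/-- **W3ʷᵇ at a solution that extends past `T`** (λ₀ = ½, R₀ = 1, every κ, ε, δ: above the regular-case threshold of W3 the
ε-misaligned relative-top window set is empty). [folklore] -/
theorem windowBulkAlignedAt_of_hasSmoothExtensionPast {ν T : ℝ} (hν : 0 < ν) (hT : 0 < T)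
    {u : ℝ → EuclideanSpace ℝ (Fin 3) → EuclideanSpace ℝ (Fin 3)}
    {p : ℝ → EuclideanSpace ℝ (Fin 3) → ℝ}
    (hcl : IsClassicalNSSolutionOn (Ico 0 T) ν 0 u p) (hLH : IsLerayHopfOn T ν 0 (u 0) u)
    (hdec : HasRapidSpatialDecay (u 0)) (hext : HasSmoothExtensionPast ν 0 u T) :
    ∃ lam0 : ℝ, lam0 < 1 ∧ ∃ R0 : ℝ, 0 < R0 ∧
      ∀ κ : ℝ, 0 < κ → ∀ ε : ℝ, 0 < ε → ∀ δ : ℝ, 0 < δ → ∃ M : ℝ, 0 < M ∧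
        ∀ t ∈ Set.Ico 0 T, ∀ x : EuclideanSpace ℝ (Fin 3), M ≤ ‖curl (u t) x‖ → κ / (T - t) ≤ ‖curl (u t) x‖ →
          volume {y : EuclideanSpace ℝ (Fin 3) | lam0 * ‖curl (u t) x‖ ≤ ‖curl (u t) y‖ ∧
              ‖x - y‖ ≤ R0 * Real.sqrt (ν / ‖curl (u t) x‖) ∧
              ε < Real.sqrt (1 - (inner ℝ (‖curl (u t) x‖⁻¹ • curl (u t) x)
                (‖curl (u t) y‖⁻¹ • curl (u t) y)) ^ 2)}
            ≤ ENNReal.ofReal (δ * Real.sqrt (ν / ‖curl (u t) x‖) ^ 3) := by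
  refine ⟨1 / 2, by norm_num, 1, one_pos, ?_⟩
  intro κ _hκ ε hε δ hδ
  obtain ⟨M, hM, hb⟩ := scaledBulkAligned_of_scaledTopAligned (ν := ν) (T := T) (ω := fun t => curl (u t))
    (fun _lam hlam _hlam1 _R hR _ε hε' =>
      scaledTopAlignmentAt_of_hasSmoothExtensionPast hν hT hcl hLH hdec hext hlam hR hε')
    (1 / 2) (by norm_num) (by norm_num) 1 one_pos ε hε δ hδ
  exact ⟨M, hM, fun t ht x hx _hrate => by simpa using hb t ht x hx⟩

/-- **W3ʷᵇ holds on every compact sub-interval of the lifespan, unconditionally** (`t ∈ [0, T'')`, `0 < T'' < T`; the rate clock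
may even be read at `T`: the hypothesis `κ/(T − t) ≤ |ω|` is simply not used). Hence all content of W3ʷᵇ is the uniformity of the
threshold as `T'' ↑ T` at a first blow-up time. [folklore] -/
theorem windowBulkAlignedAt_of_lt {ν T : ℝ} (hν : 0 < ν) (hT : 0 < T)
    {u : ℝ → EuclideanSpace ℝ (Fin 3) → EuclideanSpace ℝ (Fin 3)}
    {p : ℝ → EuclideanSpace ℝ (Fin 3) → ℝ}
    (hcl : IsClassicalNSSolutionOn (Ico 0 T) ν 0 u p) (hLH : IsLerayHopfOn T ν 0 (u 0) u)
    (hdec : HasRapidSpatialDecay (u 0)) {T'' : ℝ} (hT''0 : 0 < T'') (hT'' : T'' < T) :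
    ∃ lam0 : ℝ, lam0 < 1 ∧ ∃ R0 : ℝ, 0 < R0 ∧
      ∀ κ : ℝ, 0 < κ → ∀ ε : ℝ, 0 < ε → ∀ δ : ℝ, 0 < δ → ∃ M : ℝ, 0 < M ∧
        ∀ t ∈ Set.Ico 0 T'', ∀ x : EuclideanSpace ℝ (Fin 3), M ≤ ‖curl (u t) x‖ → κ / (T - t) ≤ ‖curl (u t) x‖ →
          volume {y : EuclideanSpace ℝ (Fin 3) | lam0 * ‖curl (u t) x‖ ≤ ‖curl (u t) y‖ ∧
              ‖x - y‖ ≤ R0 * Real.sqrt (ν / ‖curl (u t) x‖) ∧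
              ε < Real.sqrt (1 - (inner ℝ (‖curl (u t) x‖⁻¹ • curl (u t) x)
                (‖curl (u t) y‖⁻¹ • curl (u t) y)) ^ 2)}
            ≤ ENNReal.ofReal (δ * Real.sqrt (ν / ‖curl (u t) x‖) ^ 3) := by
  refine ⟨1 / 2, by norm_num, 1, one_pos, ?_⟩
  intro κ _hκ ε hε δ hδ
  obtain ⟨M, hM, hb⟩ := scaledBulkAligned_of_scaledTopAligned (ν := ν) (T := T'') (ω := fun t => curl (u t))
    (fun _lam hlam _hlam1 _R hR _ε hε' =>
      scaledTopAlignmentAt_of_lt hν hT hcl hLH hdec hT''0 hT'' hlam hR hε')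
    (1 / 2) (by norm_num) (by norm_num) 1 one_pos ε hε δ hδ
  exact ⟨M, hM, fun t ht x hx _hrate => by simpa using hb t ht x hx⟩

/-- **W3ʷᵇ is equivalent to W3ʷᵇ at first blow-up times.** The door holds iff its conclusion holds for every classical Leray–Hopf
solution from a rapidly decaying datum on `[0, T)` that does NOT extend classically past `T`. An equivalence of OPEN statements.
[folklore] -/
theorem aprioriWindowBulkAlignment_iff_singular :
    Summit.NavierStokesRegularity.NavierStokesRegularity.Theses.ScaledTopAlignment.AprioriWindowBulkAlignment ↔
    ∀ (ν T : ℝ), 0 < ν → 0 < T → ∀ (u : ℝ → EuclideanSpace ℝ (Fin 3) → EuclideanSpace ℝ (Fin 3))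
      (p : ℝ → EuclideanSpace ℝ (Fin 3) → ℝ),
      IsClassicalNSSolutionOn (Set.Ico 0 T) ν 0 u p → IsLerayHopfOn T ν 0 (u 0) u →
      HasRapidSpatialDecay (u 0) → ¬ HasSmoothExtensionPast ν 0 u T →
      ∃ lam0 : ℝ, lam0 < 1 ∧ ∃ R0 : ℝ, 0 < R0 ∧
        ∀ κ : ℝ, 0 < κ → ∀ ε : ℝ, 0 < ε → ∀ δ : ℝ, 0 < δ → ∃ M : ℝ, 0 < M ∧
          ∀ t ∈ Set.Ico 0 T, ∀ x : EuclideanSpace ℝ (Fin 3), M ≤ ‖curl (u t) x‖ → κ / (T - t) ≤ ‖curl (u t) x‖ →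
            volume {y : EuclideanSpace ℝ (Fin 3) | lam0 * ‖curl (u t) x‖ ≤ ‖curl (u t) y‖ ∧
                ‖x - y‖ ≤ R0 * Real.sqrt (ν / ‖curl (u t) x‖) ∧
                ε < Real.sqrt (1 - (inner ℝ (‖curl (u t) x‖⁻¹ • curl (u t) x)
                  (‖curl (u t) y‖⁻¹ • curl (u t) y)) ^ 2)}
              ≤ ENNReal.ofReal (δ * Real.sqrt (ν / ‖curl (u t) x‖) ^ 3) := by
  constructor
  · intro hW ν T hν hT u p hcl hLH hdec _hext
    exact hW ν T hν hT u p hcl hLH hdec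
  · intro hsing ν T hν hT u p hcl hLH hdec
    by_cases hext : HasSmoothExtensionPast ν 0 u T
    · exact windowBulkAlignedAt_of_hasSmoothExtensionPast hν hT hcl hLH hdec hext
    · exact hsing ν T hν hT u p hcl hLH hdec hext

end Summit.NavierStokesRegularity.NavierStokesRegularity.Theorems

end
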